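import Summits.BirchSwinnertonDyer.BirchSwinnertonDyer.Theses.GenusKolyvaginAtTwo

/-!
# LEAD GLUE PREVIEW g32 (crux workfile, NOT a proposal, NOT a registry edit) — for the pen's rev-68 packet, director-bsd (726)/(730)

Seat `bsd-line-gk2-p1` g32 (LEAD).  Elaborated against rev 67 (77094bcdf523).  Contents: (1) the three NEW decl TEXTS the packet adds to
`Theses/GenusKolyvaginAtTwo.lean` under free names — here SIMULATED inside a scratch namespace (so this file never clashes with the real rev-68
decls): U₂′ `RankOneNoTwoTorsionBSDTwo`, R″ `RankOneTwoTorsionResidualAtTwo`, Ш-cell `RankOneShaCellBSDTwo` — texts byte-compatible with the binders of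
p798939 `…Census.TorsionCell` and p801119 `…Census.ShaCell`, so the BY-NAME closers after rev 68 are one-line wrappers; (2) the two candidate INLINE
`closes` bodies of (730)(b) — the Theses file cannot import a Theorems module (import cycle), so `glue.lean` must inline, exactly as rev 65/67 did:
`closes6` = WALL(GK2)×4 + U₂′ + R″ (6 binders), `closes7` = WALL(GK2)×4 + U₂ `MinimalTwinBSDTwo` BY NAME + Ш-cell + R″ (7 binders); both use every
binder (one cell each); (3) the glued split U₂′ ⟸ U₂ ∧ Ш-cell by (simulated) name.  rc 0, 0 sorry.  BSD is NOT proved; nothing closed.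
-/

set_option linter.dupNamespace false

namespace Summit.BirchSwinnertonDyer.BirchSwinnertonDyer.Cruxes.MinimalTwinBSDTwo.LeadGluePreviewG32

open Summit.BirchSwinnertonDyer.BirchSwinnertonDyer.Theses.GenusKolyvaginAtTwo

open scoped BigOperators Topology Manifold Classical MeasureTheory ProbabilityTheory Matrix InnerProductSpace ComplexConjugate ContinuousMap
open Filter Set Function TopologicalSpace MeasureTheory
open Literature

/-- U₂′ — TEXT TO PASTE for the new crux decl (suggested name `RankOneNoTwoTorsionBSDTwo`): BSD₂ for every non-CM curve of analytic rank one WITHOUT rational 2-torsion (= U₂'s cell ⊔ the Ш-cell). -/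
def RankOneNoTwoTorsionBSDTwo_text : Prop :=
  ∀ (W : WeierstrassCurve ℚ) [W.IsElliptic] [W.IsGloballyMinimal], ¬ W.HasCM → W.analyticRank = 1 → (∀ P : W.toAffine.Point, 2 • P = 0 → P = 0) → Literature.NumberTheory.EllipticCurves.BSDp W 2

/-- R″ — TEXT TO PASTE for the new RESIDUAL decl (suggested name `RankOneTwoTorsionResidualAtTwo`): the TORSION cell, BSD₂ for every non-CM curve of analytic rank one WITH a rational 2-torsion point (no engine, no print). -/
def RankOneTwoTorsionResidualAtTwo_text : Prop :=
  ∀ (W : WeierstrassCurve ℚ) [W.IsElliptic] [W.IsGloballyMinimal], ¬ W.HasCM → W.analyticRank = 1 → (¬ ∀ P : W.toAffine.Point, 2 • P = 0 → P = 0) → Literature.NumberTheory.EllipticCurves.BSDp W 2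

/-- Ш-cell — TEXT TO PASTE if itemised (suggested name `RankOneShaCellBSDTwo`): BSD₂ for every non-CM curve of analytic rank one without rational 2-torsion and with `#Sel₂(W) ≠ 2` (⟺ `Ш(W)[2] ≠ 0` at rank one); road = KEX⁰|Ш (p801119 §4). -/
def RankOneShaCellBSDTwo_text : Prop :=
  ∀ (W : WeierstrassCurve ℚ) [W.IsElliptic] [W.IsGloballyMinimal], ¬ W.HasCM → W.analyticRank = 1 → (∀ P : W.toAffine.Point, 2 • P = 0 → P = 0) → Nat.card (W.selmerGroup 2) ≠ 2 → Literature.NumberTheory.EllipticCurves.BSDp W 2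

/-- 6-binder inline `closes` (form (726)(C)-2 / (730)(b) first option). -/
theorem closes6 (hOrd : WallGoodOrdinaryRankZeroAtTwo) (hMult : WallMultiplicativeRankZeroAtTwo) (hSS : WallSupersingularRankZeroAtTwo)
    (hAdd : WallAdditiveRankZeroAtTwo) (hU : RankOneNoTwoTorsionBSDTwo_text) (hT : RankOneTwoTorsionResidualAtTwo_text) :
    Summit.BirchSwinnertonDyer.BirchSwinnertonDyer.Rank1Residual.NonCMAtTwo := by
  intro W _ _ hcm hr
  rcases Nat.lt_or_ge W.analyticRank 1 with h0 | h1
  · -- analytic rank 0: WALL row 1, tetrachotomy of the reduction type at 2 inlined (no Theorems import)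
    have hr0 : W.analyticRank = 0 := Nat.lt_one_iff.mp h0
    by_cases hg : W.HasGoodReductionAtPrime 2
    · by_cases hd : ((2 : ℕ) : ℤ) ∣ W.frobeniusTrace 2
      · exact hSS W hcm hr0 ⟨hg, hd⟩
      · exact hOrd W hcm hr0 ⟨hg, hd⟩
    · by_cases hm : W.HasMultiplicativeReductionAtPrime 2
      · exact hMult W hcm hr0 hm
      · exact hAdd W hcm hr0 ⟨hg, hm⟩
  · have hr1 : W.analyticRank = 1 := le_antisymm hr h1
    by_cases htor : ∀ P : W.toAffine.Point, 2 • P = 0 → P = 0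
    · exact hU W hcm hr1 htor      -- U₂′ `RankOneNoTwoTorsionBSDTwo` by name, LOAD-BEARING (rank one, no rational 2-torsion)
    · exact hT W hcm hr1 htor      -- the declared residual R″ (rank one, rational 2-torsion)

/-- 7-binder inline `closes` (form (730)(b) second option: U₂ kept BY NAME as a binder + Ш-cell + R″). -/
theorem closes7 (hOrd : WallGoodOrdinaryRankZeroAtTwo) (hMult : WallMultiplicativeRankZeroAtTwo) (hSS : WallSupersingularRankZeroAtTwo)
    (hAdd : WallAdditiveRankZeroAtTwo) (hTw : MinimalTwinBSDTwo) (hSha : RankOneShaCellBSDTwo_text) (hT : RankOneTwoTorsionResidualAtTwo_text) :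
    Summit.BirchSwinnertonDyer.BirchSwinnertonDyer.Rank1Residual.NonCMAtTwo := by
  intro W _ _ hcm hr
  rcases Nat.lt_or_ge W.analyticRank 1 with h0 | h1
  · have hr0 : W.analyticRank = 0 := Nat.lt_one_iff.mp h0
    by_cases hg : W.HasGoodReductionAtPrime 2
    · by_cases hd : ((2 : ℕ) : ℤ) ∣ W.frobeniusTrace 2
      · exact hSS W hcm hr0 ⟨hg, hd⟩
      · exact hOrd W hcm hr0 ⟨hg, hd⟩
    · by_cases hm : W.HasMultiplicativeReductionAtPrime 2
      · exact hMult W hcm hr0 hm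
      · exact hAdd W hcm hr0 ⟨hg, hm⟩
  · have hr1 : W.analyticRank = 1 := le_antisymm hr h1
    by_cases htor : ∀ P : W.toAffine.Point, 2 • P = 0 → P = 0
    · by_cases hSel : Nat.card (W.selmerGroup 2) = 2
      · exact hTw W hcm hr1 hSel          -- U₂ `MinimalTwinBSDTwo` by name (rank one, #Sel₂ = 2)
      · exact hSha W hcm hr1 htor hSel    -- Ш-cell (rank one, W(ℚ)[2] = 0, #Sel₂ ≠ 2)
    · exact hT W hcm hr1 htor             -- residual R″ (rank one, rational 2-torsion)

/-- The glued split BY (simulated) NAME — after rev 68 this is the LEAD's one-line wrapper of p801119. -/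
theorem rankOneNoTwoTorsionBSDTwo_of_minimalTwinBSDTwo_of_shaCell (hTw : MinimalTwinBSDTwo) (hSha : RankOneShaCellBSDTwo_text) :
    RankOneNoTwoTorsionBSDTwo_text := by
  intro W _ _ hcm hr htor
  by_cases hSel : Nat.card (W.selmerGroup 2) = 2
  · exact hTw W hcm hr hSel
  · exact hSha W hcm hr htor hSel

end Summit.BirchSwinnertonDyer.BirchSwinnertonDyer.Cruxes.MinimalTwinBSDTwo.LeadGluePreviewG32
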